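import Summits.HubbardSuperconductivity.HubbardSuperconductivity.Theorems.FunctionFieldCertificateMesoscopicPairOrderNecessity
import Summits.HubbardSuperconductivity.HubbardSuperconductivity.Theorems.FunctionFieldCertificateMesoscopicPairOrderStubBoxExpectation
import Summits.HubbardSuperconductivity.HubbardSuperconductivity.Theorems.FunctionFieldCertificateMesoscopicPairOrderStubChordFloor
import Summits.HubbardSuperconductivity.HubbardSuperconductivity.Theorems.NoGoNogoSingletPairKillsSaturatedFM
import Summits.HubbardSuperconductivity.HubbardSuperconductivity.Theorems.BalabanIRBirEveryGroundStateSocket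
import Literature.Barriers.HubbardSuperconductivity.PureModelStripeCompetition

/-!
# Crux `MesoscopicPairOrder` (item `stmt-HubbardSuperconductivity-7331`): the saturated-ferromagnet exclusion region

Negative-side lemmas of the standing disprover (cdisprove cycle 1), sorry-free; workfile
`Cruxes/MesoscopicPairOrder/Disproof.lean`.  Where the witness `(U, δ)` of the crux (route
`FunctionFieldCertificate`, pole-free half: a margin `m R² ≤ T_R(ψ)/L²` for the Fejér-box pair
functional in EVERY normalised `(2⌊(1-δ)L²/2⌋, S^z = 0)`-sector ground state of `hubbardTorus 2 L 1 U`
on all large even tori, at arbitrarily large scales `R`) can NOT be.  No definition is introduced: the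
crux body at fixed `(U, δ)` and the lead's stub (with its box pair repulsion
`K_R = Σ_{x,y} W_R(y-x) P_xᴴ P_y`) are spelled out verbatim.

* `pointwise_false_of_saturated` — EXCLUSION: if for infinitely many even `L` the sector contains a
  SATURATED ferromagnetic ground state (`S² ψ = n(n+1) ψ`, `n = ⌊(1-δ)L²/2⌋`; the `S^z = 0` member of
  a top-spin multiplet, as in a Nagaoka corner), the crux body fails at `(U, δ)`: route NoGo proved that
  every local singlet pair kills a saturated ferromagnet (`NoGo.localPair_mulVec_eq_zero_of_saturated`),
  so `T_R = 0` (`boxSum_eq_zero_of_saturated`) on an admissible `ψ`.  Dually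
  `eventually_not_saturated_of_pointwise`: at the witness of any proof, eventually no sector ground
  state is saturated (every point of saturated/unsaturated ground-state degeneracy i.o. is excluded).
* `pointwise_of_hasDWavePairFieldLROAt`, `not_hasDWavePairFieldLROAt_of_saturated` — pointwise
  necessity (the summit's matrix `HasDWavePairFieldLROAt U δ` of the barrier catalogue implies the crux
  body at `(U, δ)`, by `Theorems.groundState_bound_of_forall_hasLRO` and the Fejér floor), hence the
  same exclusion for the summit's matrix (cf. `NoGo.nogoNagaokaWindow_of_saturatedFerromagnetism`).
* `pointwise_of_chordGap`, `chordGap_pointwise_false_of_saturated` — line `Sketch` (lead's pick): the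
  body of its open stub `stub_chordGap` at `(U, δ)` implies the crux body with the same `(m, R, L₀)`
  through the LANDED stubs `stub_chordFloor` (p96247) and `stub_boxExpectation` (p96295) — the line's
  joint sufficiency is honest pointwise — and therefore dies on the same exclusion region.

The ferromagnetic input is OPEN at every fixed `(U, δ)` of the range (Nagaoka 1966 / Tasaki 1989: one
hole, `U = ∞`; H. Tasaki, Prog. Theor. Phys. 99 (1998) 489, p. 21), so nothing here refutes the crux.
Sources: Tasaki 1998 p. 20; E. H. Lieb, PRL 62 (1989) 1201; D. J. Scalapino, Phys. Rep. 250 (1995)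
329, §2; folklore.
-/

noncomputable section

namespace Summit.HubbardSuperconductivity.HubbardSuperconductivity.Theorems.MesoscopicPairOrder.Negative

open Matrix Finset Filter
open Literature.Probability.LatticeModels Literature.MathematicalPhysics.QuantumLattice
open scoped ComplexOrder

/-! ### Exclusion region: saturated (Nagaoka) ferromagnetic sector ground states -/

/-- **A saturated ferromagnet has `T_R = 0` at every scale**: every local singlet pair `P_x` kills a
`2n`-particle state with `S² ψ = n(n+1) ψ` (route NoGo, `localPair_mulVec_eq_zero_of_saturated`).
Tasaki, Prog. Theor. Phys. 99 (1998) 489, p. 20. [folklore] -/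
theorem boxSum_eq_zero_of_saturated (L : ℕ) [NeZero L] (R : ℕ) {n : ℕ}
    {ψ : Fock (Orb (FermionTorus 2 L))} (hN : IsNParticle (2 * n) ψ)
    (hS : spinSq *ᵥ ψ = (((n : ℝ) * ((n : ℝ) + 1) : ℝ) : ℂ) • ψ) :
    (∑ x : TorusSite 2 L, ∑ y : TorusSite 2 L,
          (∏ i : Fin 2, max 0 (1 - |(((y i - x i).valMinAbs : ℤ) : ℝ)| / (R : ℝ))) *
            (star (localPair dWaveFormFactor L x *ᵥ ψ) ⬝ᵥ (localPair dWaveFormFactor L y *ᵥ ψ)).re) = 0 := by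
  have hS' : spinSq *ᵥ ψ =
      (((((2 * n : ℕ) : ℝ) / 2) * ((((2 * n : ℕ) : ℝ) / 2) + 1) : ℝ) : ℂ) • ψ := by
    rw [hS]; congr 2; push_cast; ring
  have h0 : ∀ x : TorusSite 2 L, localPair dWaveFormFactor L x *ᵥ ψ = 0 := fun x =>
    Summit.HubbardSuperconductivity.NoGo.localPair_mulVec_eq_zero_of_saturated dWaveFormFactor L x hN hS'
  simp [h0]

/-- **Exclusion: the crux body fails at every `(U, δ)` with saturated sector ground states along
infinitely many even sides.** If for infinitely many even `L` the `(2n, S^z = 0)` sector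
(`n = ⌊(1-δ)L²/2⌋`) of `hubbardTorus 2 L 1 U` contains a ground state with `S² ψ = n(n+1) ψ`, then no
margin `m > 0` works at `(U, δ)`: normalised, that ground state is admissible and has `T_R = 0 < m R²`
for the `R ≥ 1` the crux must supply at `R₀ = 1`. So the witness `(U, δ)` of any proof lies where the
sector ground states are eventually NOT saturated ferromagnets (the Nagaoka corner, and every point of
degeneracy between saturated and unsaturated ground states i.o., are excluded). [folklore] -/
theorem pointwise_false_of_saturated {U δ : ℝ}
    (hsat : ∃ᶠ L : ℕ in atTop, Even L ∧ ∃ ψ : Fock (Orb (FermionTorus 2 L)),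
      IsGroundStateInSector (hubbardTorus 2 L 1 U) (2 * ⌊(1 - δ) * (L : ℝ) ^ 2 / 2⌋₊) 0 ψ ∧
        spinSq *ᵥ ψ = (((⌊(1 - δ) * (L : ℝ) ^ 2 / 2⌋₊ : ℝ) *
          ((⌊(1 - δ) * (L : ℝ) ^ 2 / 2⌋₊ : ℝ) + 1) : ℝ) : ℂ) • ψ) :
    ¬ (∃ m : ℝ, 0 < m ∧ ∀ R₀ : ℕ, ∃ R : ℕ, R₀ ≤ R ∧ ∃ L₀ : ℕ, ∀ (L : ℕ) [NeZero L], L₀ ≤ L → Even L →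
        ∀ ψ : Fock (Orb (FermionTorus 2 L)), star ψ ⬝ᵥ ψ = 1 →
          IsGroundStateInSector (hubbardTorus 2 L 1 U) (2 * ⌊(1 - δ) * (L : ℝ) ^ 2 / 2⌋₊) 0 ψ →
            m * (R : ℝ) ^ 2 ≤ (∑ x : TorusSite 2 L, ∑ y : TorusSite 2 L,
                  (∏ i : Fin 2, max 0 (1 - |(((y i - x i).valMinAbs : ℤ) : ℝ)| / (R : ℝ))) *
                    (star (localPair dWaveFormFactor L x *ᵥ ψ) ⬝ᵥ (localPair dWaveFormFactor L y *ᵥ ψ)).re) / (L : ℝ) ^ 2) := by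
  rintro ⟨m, hm, hall⟩
  obtain ⟨R, hR, L₀, hL⟩ := hall 1
  obtain ⟨L, ⟨hEven, ψ, hgs, hS⟩, hLge⟩ :=
    (hsat.and_eventually (eventually_ge_atTop (max L₀ 1))).exists
  have hL0 : L₀ ≤ L := le_of_max_le_left hLge
  have hL1 : 1 ≤ L := le_of_max_le_right hLge
  haveI : NeZero L := ⟨by omega⟩
  obtain ⟨c, hc, hc1⟩ := Literature.MathematicalPhysics.QuantumLattice.exists_smul_unit hgs.2.1
  have hgs' := Summit.HubbardSuperconductivity.NoGo.isGroundStateInSector_smul _ _ _ hgs hc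
  have hN : IsNParticle (2 * ⌊(1 - δ) * (L : ℝ) ^ 2 / 2⌋₊) (c • ψ) :=
    ((mem_szSector_iff _ _ _).1 hgs'.1).1
  have hSc : spinSq *ᵥ (c • ψ) = (((⌊(1 - δ) * (L : ℝ) ^ 2 / 2⌋₊ : ℝ) *
      ((⌊(1 - δ) * (L : ℝ) ^ 2 / 2⌋₊ : ℝ) + 1) : ℝ) : ℂ) • (c • ψ) := by
    rw [mulVec_smul, hS, smul_comm]
  have hbad := hL L hL0 hEven (c • ψ) hc1 hgs'
  rw [boxSum_eq_zero_of_saturated L R hN hSc, zero_div] at hbad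
  have hRpos : (1 : ℝ) ≤ R := by exact_mod_cast hR
  have hR2 : (1 : ℝ) ≤ (R : ℝ) ^ 2 := by nlinarith
  have hmR : m ≤ m * (R : ℝ) ^ 2 := le_mul_of_one_le_right hm.le hR2
  linarith

/-- Dual form: **where the crux body holds, eventually (along even sides) NO sector ground state is a
saturated ferromagnet.** [folklore] -/
theorem eventually_not_saturated_of_pointwise {U δ : ℝ}
    (h : ∃ m : ℝ, 0 < m ∧ ∀ R₀ : ℕ, ∃ R : ℕ, R₀ ≤ R ∧ ∃ L₀ : ℕ, ∀ (L : ℕ) [NeZero L], L₀ ≤ L → Even L →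
        ∀ ψ : Fock (Orb (FermionTorus 2 L)), star ψ ⬝ᵥ ψ = 1 →
          IsGroundStateInSector (hubbardTorus 2 L 1 U) (2 * ⌊(1 - δ) * (L : ℝ) ^ 2 / 2⌋₊) 0 ψ →
            m * (R : ℝ) ^ 2 ≤ (∑ x : TorusSite 2 L, ∑ y : TorusSite 2 L,
                  (∏ i : Fin 2, max 0 (1 - |(((y i - x i).valMinAbs : ℤ) : ℝ)| / (R : ℝ))) *
                    (star (localPair dWaveFormFactor L x *ᵥ ψ) ⬝ᵥ (localPair dWaveFormFactor L y *ᵥ ψ)).re) / (L : ℝ) ^ 2) :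
    ∀ᶠ L : ℕ in atTop, Even L → ∀ ψ : Fock (Orb (FermionTorus 2 L)),
      IsGroundStateInSector (hubbardTorus 2 L 1 U) (2 * ⌊(1 - δ) * (L : ℝ) ^ 2 / 2⌋₊) 0 ψ →
        spinSq *ᵥ ψ ≠ (((⌊(1 - δ) * (L : ℝ) ^ 2 / 2⌋₊ : ℝ) *
          ((⌊(1 - δ) * (L : ℝ) ^ 2 / 2⌋₊ : ℝ) + 1) : ℝ) : ℂ) • ψ := by
  have hns := mt (pointwise_false_of_saturated (U := U) (δ := δ)) (not_not.2 h)
  rw [Filter.not_frequently] at hns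
  filter_upwards [hns] with L hL hE ψ hgs hS
  exact hL ⟨hE, ψ, hgs, hS⟩

/-! ### Pointwise necessity: the summit's matrix at `(U, δ)` implies the crux body at `(U, δ)` -/

/-- **Pointwise necessity**: the summit's matrix at `(U, δ)` (catalogue def
`Literature.Barriers.HubbardSuperconductivity.HasDWavePairFieldLROAt`) implies the crux body at
`(U, δ)` (compactness bound `Theorems.groundState_bound_of_forall_hasLRO` + Fejér floor
`fejerBox_floor_pairField`, as in the tree's global `mesoscopicPairOrder_of_hubbardSuperconductivity`).
Hence a pointwise failure of the crux is a pointwise failure of the summit. [folklore] -/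
theorem pointwise_of_hasDWavePairFieldLROAt {U δ : ℝ} (hδ : δ ∈ Set.Ioo (0:ℝ) (1 / 2))
    (h : Literature.Barriers.HubbardSuperconductivity.HasDWavePairFieldLROAt U δ) :
    ∃ m : ℝ, 0 < m ∧ ∀ R₀ : ℕ, ∃ R : ℕ, R₀ ≤ R ∧ ∃ L₀ : ℕ, ∀ (L : ℕ) [NeZero L], L₀ ≤ L → Even L →
      ∀ ψ : Fock (Orb (FermionTorus 2 L)), star ψ ⬝ᵥ ψ = 1 →
        IsGroundStateInSector (hubbardTorus 2 L 1 U) (2 * ⌊(1 - δ) * (L : ℝ) ^ 2 / 2⌋₊) 0 ψ →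
          m * (R : ℝ) ^ 2 ≤ (∑ x : TorusSite 2 L, ∑ y : TorusSite 2 L,
                (∏ i : Fin 2, max 0 (1 - |(((y i - x i).valMinAbs : ℤ) : ℝ)| / (R : ℝ))) *
                  (star (localPair dWaveFormFactor L x *ᵥ ψ) ⬝ᵥ (localPair dWaveFormFactor L y *ᵥ ψ)).re) / (L : ℝ) ^ 2 := by
  obtain ⟨c, hc, L₀, hbound⟩ :=
    Theorems.groundState_bound_of_forall_hasLRO U δ (by linarith [hδ.1]) h
  refine ⟨c, hc, fun R₀ => ⟨max R₀ 1, le_max_left _ _, max L₀ (2 * max R₀ 1), ?_⟩⟩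
  intro L _ hL hE ψ hψ1 hgs
  set R : ℕ := max R₀ 1 with hRdef
  have hR : 0 < R := lt_of_lt_of_le Nat.one_pos (le_max_right _ _)
  have hRL : 2 * R ≤ L := le_of_max_le_right hL
  have hLpos : (0 : ℝ) < L := Nat.cast_pos.2 (Nat.pos_of_ne_zero (NeZero.ne L))
  have hL2 : (0 : ℝ) < (L : ℝ) ^ 2 := by positivity
  have hfloor := Theorems.FunctionFieldCertificate.fejerBox_floor_pairField dWaveFormFactor L R hR hRL ψ
  have ha' := hbound L (le_of_max_le_left hL) hE ψ hgs hψ1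
  rw [le_div_iff₀ hL2]
  rw [div_le_iff₀ hL2] at hfloor
  have hR2 : (0 : ℝ) ≤ (R : ℝ) ^ 2 := by positivity
  nlinarith [hfloor, ha', hR2]

/-- **No `d`-wave pair-field LRO (the summit's matrix) at any `(U, δ)` with saturated sector ground
states infinitely often along even sides** (cf. `NoGo.nogoNagaokaWindow_of_saturatedFerromagnetism`;
here through the crux body). [folklore] -/
theorem not_hasDWavePairFieldLROAt_of_saturated {U δ : ℝ} (hδ : δ ∈ Set.Ioo (0:ℝ) (1 / 2))
    (hsat : ∃ᶠ L : ℕ in atTop, Even L ∧ ∃ ψ : Fock (Orb (FermionTorus 2 L)),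
      IsGroundStateInSector (hubbardTorus 2 L 1 U) (2 * ⌊(1 - δ) * (L : ℝ) ^ 2 / 2⌋₊) 0 ψ ∧
        spinSq *ᵥ ψ = (((⌊(1 - δ) * (L : ℝ) ^ 2 / 2⌋₊ : ℝ) *
          ((⌊(1 - δ) * (L : ℝ) ^ 2 / 2⌋₊ : ℝ) + 1) : ℝ) : ℂ) • ψ) :
    ¬ Literature.Barriers.HubbardSuperconductivity.HasDWavePairFieldLROAt U δ :=
  fun h => pointwise_false_of_saturated hsat (pointwise_of_hasDWavePairFieldLROAt hδ h)

/-! ### Line `Sketch` (lead's pick): the chord-gap stub at fixed `(U, δ)` -/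

/-- **Joint sufficiency of line `Sketch` is honest, pointwise**: the body of the lead's open stub
`stub_chordGap` at fixed `(U, δ)` (an extensive chord gap `ε m R² L² ≤ E_K(H_L + ε K_R) - E_K(H_L)`,
`ε > 0` allowed to depend on `L`) implies the crux body at `(U, δ)` with the SAME `(m, R, L₀)`, through
the two LANDED stubs (`stub_chordFloor` p96247, `stub_boxExpectation` p96295). [folklore] -/
theorem pointwise_of_chordGap {U δ : ℝ}
    (h : ∃ m : ℝ, 0 < m ∧ ∀ R₀ : ℕ, ∃ R : ℕ, R₀ ≤ R ∧ ∃ L₀ : ℕ, ∀ (L : ℕ) [NeZero L], L₀ ≤ L → Even L →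
      ∃ ε : ℝ, 0 < ε ∧
        ε * (m * (R : ℝ) ^ 2 * (L : ℝ) ^ 2) ≤
          (hubbardTorus 2 L 1 U + (ε : ℂ) • (∑ x : TorusSite 2 L, ∑ y : TorusSite 2 L,
                ((∏ i : Fin 2, max 0 (1 - |(((y i - x i).valMinAbs : ℤ) : ℝ)| / (R : ℝ)) : ℝ) : ℂ) •
                  ((localPair dWaveFormFactor L x)ᴴ * localPair dWaveFormFactor L y))).minEnergyOn
              (szSector (2 * ⌊(1 - δ) * (L : ℝ) ^ 2 / 2⌋₊) 0) -
            (hubbardTorus 2 L 1 U).minEnergyOn (szSector (2 * ⌊(1 - δ) * (L : ℝ) ^ 2 / 2⌋₊) 0)) :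
    ∃ m : ℝ, 0 < m ∧ ∀ R₀ : ℕ, ∃ R : ℕ, R₀ ≤ R ∧ ∃ L₀ : ℕ, ∀ (L : ℕ) [NeZero L], L₀ ≤ L → Even L →
      ∀ ψ : Fock (Orb (FermionTorus 2 L)), star ψ ⬝ᵥ ψ = 1 →
        IsGroundStateInSector (hubbardTorus 2 L 1 U) (2 * ⌊(1 - δ) * (L : ℝ) ^ 2 / 2⌋₊) 0 ψ →
          m * (R : ℝ) ^ 2 ≤ (∑ x : TorusSite 2 L, ∑ y : TorusSite 2 L,
                (∏ i : Fin 2, max 0 (1 - |(((y i - x i).valMinAbs : ℤ) : ℝ)| / (R : ℝ))) *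
                  (star (localPair dWaveFormFactor L x *ᵥ ψ) ⬝ᵥ (localPair dWaveFormFactor L y *ᵥ ψ)).re) / (L : ℝ) ^ 2 := by
  obtain ⟨m, hm, hall⟩ := h
  refine ⟨m, hm, fun R₀ => ?_⟩
  obtain ⟨R, hR₀, L₀, hL⟩ := hall R₀
  refine ⟨R, hR₀, L₀, ?_⟩
  intro L _ hL₀ hE ψ hψ hgs
  obtain ⟨ε, hε, hgap⟩ := hL L hL₀ hE
  have hchord := Theorems.FunctionFieldCertificate.stub_chordFloor L U ε
    (2 * ⌊(1 - δ) * (L : ℝ) ^ 2 / 2⌋₊) ((∑ x : TorusSite 2 L, ∑ y : TorusSite 2 L,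
          ((∏ i : Fin 2, max 0 (1 - |(((y i - x i).valMinAbs : ℤ) : ℝ)| / (R : ℝ)) : ℝ) : ℂ) •
            ((localPair dWaveFormFactor L x)ᴴ * localPair dWaveFormFactor L y))) ψ hε hψ hgs
  rw [Theorems.FunctionFieldCertificate.stub_boxExpectation L R ψ] at hchord
  have hLpos : (0 : ℝ) < L := Nat.cast_pos.2 (Nat.pos_of_ne_zero (NeZero.ne L))
  rw [le_div_iff₀ (by positivity)]
  have := le_of_mul_le_mul_left (hgap.trans hchord) hε
  linarith

/-- **The stub dies on the exclusion region too**: saturated sector ground states infinitely often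
along even sides at `(U, δ)` refute the body of `stub_chordGap` at `(U, δ)` (the saturated ground state
is a trial state of the penalised problem with `⟨K_R⟩ = T_R = 0`). [folklore] -/
theorem chordGap_pointwise_false_of_saturated {U δ : ℝ}
    (hsat : ∃ᶠ L : ℕ in atTop, Even L ∧ ∃ ψ : Fock (Orb (FermionTorus 2 L)),
      IsGroundStateInSector (hubbardTorus 2 L 1 U) (2 * ⌊(1 - δ) * (L : ℝ) ^ 2 / 2⌋₊) 0 ψ ∧
        spinSq *ᵥ ψ = (((⌊(1 - δ) * (L : ℝ) ^ 2 / 2⌋₊ : ℝ) *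
          ((⌊(1 - δ) * (L : ℝ) ^ 2 / 2⌋₊ : ℝ) + 1) : ℝ) : ℂ) • ψ) :
    ¬ (∃ m : ℝ, 0 < m ∧ ∀ R₀ : ℕ, ∃ R : ℕ, R₀ ≤ R ∧ ∃ L₀ : ℕ, ∀ (L : ℕ) [NeZero L], L₀ ≤ L → Even L →
      ∃ ε : ℝ, 0 < ε ∧
        ε * (m * (R : ℝ) ^ 2 * (L : ℝ) ^ 2) ≤
          (hubbardTorus 2 L 1 U + (ε : ℂ) • (∑ x : TorusSite 2 L, ∑ y : TorusSite 2 L,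
                ((∏ i : Fin 2, max 0 (1 - |(((y i - x i).valMinAbs : ℤ) : ℝ)| / (R : ℝ)) : ℝ) : ℂ) •
                  ((localPair dWaveFormFactor L x)ᴴ * localPair dWaveFormFactor L y))).minEnergyOn
              (szSector (2 * ⌊(1 - δ) * (L : ℝ) ^ 2 / 2⌋₊) 0) -
            (hubbardTorus 2 L 1 U).minEnergyOn (szSector (2 * ⌊(1 - δ) * (L : ℝ) ^ 2 / 2⌋₊) 0)) :=
  fun h => pointwise_false_of_saturated hsat (pointwise_of_chordGap h)

end Summit.HubbardSuperconductivity.HubbardSuperconductivity.Theorems.MesoscopicPairOrder.Negative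

end
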